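/-
Copyright: the b2b-balaban T⁴-continuum CRUX team, row NE7b, leaf lineage `t4-ne7b-formalise-leaf-02` (gen 130). Project licence.
-/
import Summits.QuantumFields.BalabanUV.T4Continuum.Spine.NE7b.ConvexWindowSuppliersLocal

/-!
# THE CELL COUNT: the block fibre sums of a SUM OF CELL-LOCAL TERMS are at most (cells per block) × (per-cell block table) — `M ≤ ν·c`,
# a count of the interaction pattern, independent of the volume — and the windowed road's block-Schur END for `Σ_p P_p` BY NAME with
# `M := ν·c` (row NE7b, node U5c; letter (ℓ1), the block twin of `…ConvexWindowSuppliersLocal` §3: the desk's «plaquettes per bond × block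
# row constant» shape, ρ-ne7bref-g74-1 ∕ g75-1, AS A THEOREM)

Cell `pub-balaban`, sub-cell `t4`, spine estimate NE7b (`T4WeightBudget.RelWeightBound`; the cell's OWN estimate — NOT PRINTED in
[Bałaban 1983–89], NOT PROVED).  Crux-route work under `Spine/NE7b/` by the row's E-side ∕ key-readings leaf lineage; NOTHING of
Bałaban's is named or asserted; no `T4Continuum/Support` leaf typed; no `def`; zero `sorry`.  Imports: this lineage's `…ConvexWindowSuppliersLocal`.

WHY.  `…ConvexWindowSuppliersLocal` §5 (p372269 ✓) reads the road's third-derivative letter in the block-Schur currency: fibre sums over the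
middle ∕ last block index of the block entries `‖D³P(z) ∘ (Q_{r0},Q_{r1},Q_{r2})‖_op` bounded by `M` ON the window ⟹ modulus
`2σ − (‖D²P(0)‖ + M·a)` on T-61's per-bond window — with `M` DISPLAYED.  Its §3 has the SCALAR locality count (entries supported in an
interaction set, `≤ ν·τ`), but not the block one.  Print's anharmonic remainder is a SUM OVER PLAQUETTES of terms each reading the few bond
blocks of its plaquette; the sibling `…PlaquetteCubicBlockTable` (this seat) supplies the PER-PLAQUETTE table for the leading cubic (`c = 6|g|`),
and the desk's lattice constant is «per-plaquette constant × plaquettes per bond» (ρ-ne7bref-g75-1: `36 = 6 × 6`).  THIS FILE is that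
multiplication AS A THEOREM, once and for all terms: block entries are sub-additive over the sum of terms, a term reading only its cell's
blocks has NO entry off the cell, and the double count over the cells through a block gives `M ≤ ν·c` — so the (A3) instance owes a table
PER CELL and the overlap number `ν` (a lattice-geometric count: `2(d−1)` plaquettes per bond), nothing global.

WHAT IS PROVED ([folklore]; `E = EuclideanSpace ℝ (Fin n)`, cells `p : 𝔓`, blocks `b : B`, block maps `Q_b`, supports `S_p : Finset B`):
* §1 `compContinuousLinearMap_sum`, **`norm_compContinuousLinearMap_sum_le`** (`‖(Σ_p f_p) ∘ (q₀,q₁,q₂)‖_op ≤ Σ_p ‖f_p ∘ (q₀,q₁,q₂)‖_op`).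
* §2 **`blockFibreSum_le_of_cellLocal`**: locality in slot `s` (`f_p ∘ (Q_{r0},Q_{r1},Q_{r2}) = 0` when `r s ∉ S_p`) + per-cell fibre sums `≤ c` at
  the blocks of `S_p` + every block in `≤ ν` supports ⟹ every fibre sum of the block entries of `Σ_p f_p` over `{r | r s = b}` is `≤ ν·c`.
* §3 **`blockEntry_eq_zero_of_factor`** (locality SUPPLIED: `P = G ∘ π`, `G ∈ C³`, `π ∘ Q_b = 0` off `S` ⟹ `D³P(z) ∘ (Q_{r0},Q_{r1},Q_{r2}) = 0`
  whenever some `r s ∉ S` — Mathlib's `ContinuousLinearMap.iteratedFDeriv_comp_right` and a zero slot), `cellProj_comp_eq_zero` (`π = Σ_{b ∈ S} Q_b`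
  kills the blocks off `S` for mutually annihilating `Q_b`).
* §4 **`blockFibreSum_thirdDeriv_sum_le`** (the derivative form ON a window `K`: `Σ_{r : r s = b} ‖D³(Σ_p P_p)(z) ∘ (Q_{r0},Q_{r1},Q_{r2})‖_op ≤ ν·c`
  for `z ∈ K`; Mathlib's `iteratedFDeriv_fun_sum_apply`) and the END BY NAME **`firstOrderOn_quadratic_add_sum_of_cellTables_blockWindow`** =
  `…Local.firstOrderOn_quadratic_add_of_blockFibreSums_blockWindow` for `P = Σ_p P_p` with `M := ν·c`: modulus `2σ − (‖D²P(0)‖ + ν·c·a)` on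
  `L ∩ ⋂_b {‖Q_b y‖ ≤ a}`, the locality and the per-cell tables asked only in the two slots the Schur test reads (`s ≠ 0`).

NOT HERE (honest): the per-cell tables themselves (`…PlaquetteCubicBlockTable` for the cubic; higher Taylor terms ∕ non-flat backgrounds: their
own tables); the lattice geometry (`ν = 2(d−1)` on a torus, the bond-block chart of a whole lattice and each plaquette term as `G ∘ π_p`) — the
(A3) instance's bookkeeping; `σ`, `a`, the chart ((A3) ∕ (A1c); NC-NE7b-α UNRULED); anything of Bałaban's.  BY-NAME EFFECT ON THE WALL: NONE.
NE7b NOT PRINTED ∕ NOT PROVED; spine PROVED 0∕9; rung (B)+1 on a FINITE torus — NOT infinite volume, NOT the mass gap, NOT Clay.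
HONEST DEPENDENCY: continuum YM on T⁴ ⇐ BetaPertH ∧ nine spine estimates (0/9 proved); BetaPertH ⇐ (D1) ∧ (D4) ∧ CAP+tail.
-/

set_option autoImplicit false

noncomputable section

open Real InnerProductSpace Set Finset
open scoped RealInnerProductSpace Gradient
open Summit.QuantumFields.BalabanUV.T4Continuum.NE7b.ConvexWindowSuppliersLocal

namespace Summit.QuantumFields.BalabanUV.T4Continuum.NE7b.ConvexWindowSuppliersCells

variable {n : ℕ} {𝔓 B : Type*} [Fintype 𝔓] [Fintype B] [DecidableEq B]

/-! ## §1 Block entries are sub-additive over a sum of terms -/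

/-- The block entries of a finite sum of trilinear forms are the sums of the block entries (composition with fixed linear maps is additive).
[folklore] -/
theorem compContinuousLinearMap_sum (f : 𝔓 → ContinuousMultilinearMap ℝ (fun _ : Fin 3 => EuclideanSpace ℝ (Fin n)) ℝ)
    (q : Fin 3 → EuclideanSpace ℝ (Fin n) →L[ℝ] EuclideanSpace ℝ (Fin n)) :
    (∑ p, f p).compContinuousLinearMap q = ∑ p, (f p).compContinuousLinearMap q := by
  ext m
  simp [ContinuousMultilinearMap.compContinuousLinearMap_apply]

/-- **SUB-ADDITIVITY OF THE BLOCK ENTRIES**: `‖(Σ_p f_p) ∘ (q₀,q₁,q₂)‖_op ≤ Σ_p ‖f_p ∘ (q₀,q₁,q₂)‖_op`. [folklore] -/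
theorem norm_compContinuousLinearMap_sum_le (f : 𝔓 → ContinuousMultilinearMap ℝ (fun _ : Fin 3 => EuclideanSpace ℝ (Fin n)) ℝ)
    (q : Fin 3 → EuclideanSpace ℝ (Fin n) →L[ℝ] EuclideanSpace ℝ (Fin n)) :
    ‖(∑ p, f p).compContinuousLinearMap q‖ ≤ ∑ p, ‖(f p).compContinuousLinearMap q‖ := by
  rw [compContinuousLinearMap_sum]
  exact norm_sum_le _ _

/-! ## §2 The cell count: block fibre sums of a sum of cell-local terms are bounded by (cells per block) × (per-cell table) -/

/-- **THE CELL COUNT** (the block twin of `…ConvexWindowSuppliersLocal.fibreSum_le_of_local`, the desk's «plaquettes per bond × block row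
constant» shape).  `f = Σ_p f_p` a sum of trilinear forms over cells `p` with block supports `S_p ⊆ B`; LOCALITY in slot `s`: the block entry
`f_p ∘ (Q_{r0}, Q_{r1}, Q_{r2})` vanishes whenever `r s ∉ S_p`; PER-CELL TABLE: for every `p` and every `b ∈ S_p` the fibre sum of the block entries
of `f_p` over `{r | r s = b}` is `≤ c` (`0 ≤ c`); OVERLAP: every block lies in at most `ν` supports.  Then every fibre sum of the block entries of `f`
over `{r | r s = b}` is `≤ ν·c` — a count of the interaction pattern, independent of the number of cells and of blocks. [folklore] -/
theorem blockFibreSum_le_of_cellLocal (f : 𝔓 → ContinuousMultilinearMap ℝ (fun _ : Fin 3 => EuclideanSpace ℝ (Fin n)) ℝ)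
    (Q : B → EuclideanSpace ℝ (Fin n) →L[ℝ] EuclideanSpace ℝ (Fin n)) (S : 𝔓 → Finset B) (s : Fin 3)
    (hloc : ∀ p (r : Fin 3 → B), r s ∉ S p → (f p).compContinuousLinearMap (fun i => Q (r i)) = 0)
    {c : ℝ} (hc : 0 ≤ c)
    (hcell : ∀ p, ∀ b ∈ S p, ∑ r ∈ univ.filter (fun r : Fin 3 → B => r s = b), ‖(f p).compContinuousLinearMap (fun i => Q (r i))‖ ≤ c)
    {ν : ℕ} (hν : ∀ b, (univ.filter fun p => b ∈ S p).card ≤ ν) (b : B) :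
    ∑ r ∈ univ.filter (fun r : Fin 3 → B => r s = b), ‖(∑ p, f p).compContinuousLinearMap (fun i => Q (r i))‖ ≤ ν * c := by
  calc ∑ r ∈ univ.filter (fun r : Fin 3 → B => r s = b), ‖(∑ p, f p).compContinuousLinearMap (fun i => Q (r i))‖
      ≤ ∑ r ∈ univ.filter (fun r : Fin 3 → B => r s = b), ∑ p, ‖(f p).compContinuousLinearMap (fun i => Q (r i))‖ :=
        Finset.sum_le_sum fun r _ => norm_compContinuousLinearMap_sum_le f _
    _ = ∑ p, ∑ r ∈ univ.filter (fun r : Fin 3 → B => r s = b), ‖(f p).compContinuousLinearMap (fun i => Q (r i))‖ := Finset.sum_comm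
    _ = ∑ p ∈ univ.filter (fun p => b ∈ S p),
          ∑ r ∈ univ.filter (fun r : Fin 3 → B => r s = b), ‖(f p).compContinuousLinearMap (fun i => Q (r i))‖ := by
        rw [← Finset.sum_filter_add_sum_filter_not univ (fun p => b ∈ S p), add_eq_left]
        refine Finset.sum_eq_zero fun p hp => Finset.sum_eq_zero fun r hr => ?_
        rw [hloc p r (by rw [(Finset.mem_filter.1 hr).2]; exact (Finset.mem_filter.1 hp).2), norm_zero]
    _ ≤ ∑ _p ∈ univ.filter (fun p => b ∈ S p), c := Finset.sum_le_sum fun p hp => hcell p b (Finset.mem_filter.1 hp).2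
    _ ≤ ν * c := by
        rw [Finset.sum_const, nsmul_eq_mul]
        exact mul_le_mul_of_nonneg_right (by exact_mod_cast hν b) hc

/-! ## §3 Locality from factorisation: a term that reads only the cell's blocks has no block entry off the cell -/

omit [Fintype B] [DecidableEq B] in
/-- **A TERM THAT FACTORS THROUGH THE CELL's BLOCKS IS BLOCK-LOCAL IN EVERY SLOT.**  If `P = G ∘ π` with `G ∈ C³` and `π` a continuous linear map
killing every block off the support (`π ∘ Q_b = 0` for `b ∉ S`) — e.g. `π = Σ_{b ∈ S} Q_b` for mutually annihilating block projections — then for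
every block triple `r` with some `r s ∉ S` the block entry `D³P(z) ∘ (Q_{r0}, Q_{r1}, Q_{r2})` vanishes (chain rule `D³(G ∘ π)(z) = D³G(πz) ∘ (π,π,π)`,
Mathlib's `ContinuousLinearMap.iteratedFDeriv_comp_right`, and a zero slot). [folklore] -/
theorem blockEntry_eq_zero_of_factor {G : EuclideanSpace ℝ (Fin n) → ℝ} (hG : ContDiff ℝ 3 G)
    (πc : EuclideanSpace ℝ (Fin n) →L[ℝ] EuclideanSpace ℝ (Fin n)) (Q : B → EuclideanSpace ℝ (Fin n) →L[ℝ] EuclideanSpace ℝ (Fin n))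
    (S : Finset B) (hπ : ∀ b, b ∉ S → πc.comp (Q b) = 0) (z : EuclideanSpace ℝ (Fin n)) (r : Fin 3 → B) (s : Fin 3) (hs : r s ∉ S) :
    (iteratedFDeriv ℝ 3 (fun x => G (πc x)) z).compContinuousLinearMap (fun i => Q (r i)) = 0 := by
  have hcomp : (fun x => G (πc x)) = G ∘ ⇑πc := rfl
  rw [hcomp, ContinuousLinearMap.iteratedFDeriv_comp_right πc hG z le_rfl]
  ext m
  rw [ContinuousMultilinearMap.compContinuousLinearMap_apply, ContinuousMultilinearMap.compContinuousLinearMap_apply, zero_apply]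
  refine (iteratedFDeriv ℝ 3 G (πc z)).map_coord_zero s ?_
  show πc (Q (r s) (m s)) = 0
  rw [← ContinuousLinearMap.comp_apply, hπ (r s) hs, zero_apply]

omit [Fintype B] [DecidableEq B] in
/-- The cell projection `π = Σ_{b ∈ S} Q_b` of a family of mutually annihilating block projections kills the blocks off `S`. [folklore] -/
theorem cellProj_comp_eq_zero (Q : B → EuclideanSpace ℝ (Fin n) →L[ℝ] EuclideanSpace ℝ (Fin n))
    (hann : ∀ b b', b ≠ b' → (Q b).comp (Q b') = 0) (S : Finset B) (b : B) (hb : b ∉ S) :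
    (∑ b' ∈ S, Q b').comp (Q b) = 0 := by
  rw [ContinuousLinearMap.finsetSum_comp]
  exact Finset.sum_eq_zero fun b' hb' => hann b' b (fun h => hb (h ▸ hb'))

/-! ## §4 The derivative form and the END on T-61's window BY NAME with `M = ν·c` -/

/-- **THE BLOCK FIBRE SUMS OF `D³(Σ_p P_p)` FROM PER-CELL TABLES.**  `P_p ∈ C³`, each `D³P_p(z)` block-local in slot `s` w.r.t. `S_p` for `z ∈ K`,
per-cell tables `≤ c` ON `K`, overlap `≤ ν` ⟹ `Σ_{r : r s = b} ‖D³(Σ_p P_p)(z) ∘ (Q_{r0},Q_{r1},Q_{r2})‖_op ≤ ν·c` for `z ∈ K`. [folklore] -/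
theorem blockFibreSum_thirdDeriv_sum_le (Pp : 𝔓 → EuclideanSpace ℝ (Fin n) → ℝ) (hP : ∀ p, ContDiff ℝ 3 (Pp p))
    (Q : B → EuclideanSpace ℝ (Fin n) →L[ℝ] EuclideanSpace ℝ (Fin n)) (S : 𝔓 → Finset B) (s : Fin 3)
    (K : Set (EuclideanSpace ℝ (Fin n)))
    (hloc : ∀ z ∈ K, ∀ p (r : Fin 3 → B), r s ∉ S p →
      (iteratedFDeriv ℝ 3 (Pp p) z).compContinuousLinearMap (fun i => Q (r i)) = 0)
    {c : ℝ} (hc : 0 ≤ c)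
    (hcell : ∀ z ∈ K, ∀ p, ∀ b ∈ S p, ∑ r ∈ univ.filter (fun r : Fin 3 → B => r s = b),
      ‖(iteratedFDeriv ℝ 3 (Pp p) z).compContinuousLinearMap (fun i => Q (r i))‖ ≤ c)
    {ν : ℕ} (hν : ∀ b, (univ.filter fun p => b ∈ S p).card ≤ ν) :
    ∀ z ∈ K, ∀ b : B, ∑ r ∈ univ.filter (fun r : Fin 3 → B => r s = b),
      ‖(iteratedFDeriv ℝ 3 (fun x => ∑ p, Pp p x) z).compContinuousLinearMap (fun i => Q (r i))‖ ≤ ν * c := by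
  intro z hz b
  rw [iteratedFDeriv_fun_sum_apply fun p _ => (hP p).contDiffAt]
  exact blockFibreSum_le_of_cellLocal (fun p => iteratedFDeriv ℝ 3 (Pp p) z) Q S s (hloc z hz) hc (hcell z hz) hν b

/-- **THE END ON T-61's WINDOW FOR A SUM OF CELL-LOCAL TERMS, BY NAME** (`…ConvexWindowSuppliersLocal.firstOrderOn_quadratic_add_of_blockFibreSums_blockWindow`
with `M := ν·c`): `Q_b` a decomposition of the identity by idempotents with Pythagoras, `K = L ∩ ⋂_b {‖Q_b y‖ ≤ a}`, `A` symmetric `σ`-coercive,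
`P = Σ_p P_p` with `P_p ∈ C³` block-local in the middle and last slots ON `K`, per-cell tables `≤ c` ON `K` in both slots, every block in at most
`ν` cells ⟹ modulus `2σ − (‖D²P(0)‖ + ν·c·a)` ON `K`.  The displayed numbers: `σ`, the per-cell constant `c` (for the plaquette cubic `6|g|`,
`…PlaquetteCubicBlockTable`), the overlap `ν` (plaquettes per bond, `2(d−1)`), the per-block radius `a`. [folklore] -/
theorem firstOrderOn_quadratic_add_sum_of_cellTables_blockWindow [Nonempty B]
    (A : EuclideanSpace ℝ (Fin n) →L[ℝ] EuclideanSpace ℝ (Fin n))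
    (Q : B → EuclideanSpace ℝ (Fin n) →L[ℝ] EuclideanSpace ℝ (Fin n))
    (hQ : ∀ x, ∑ b, Q b x = x) (hQ2 : ∀ x, ∑ b, ‖Q b x‖ ^ 2 = ‖x‖ ^ 2) (hidem : ∀ b x, Q b (Q b x) = Q b x)
    (L : Submodule ℝ (EuclideanSpace ℝ (Fin n))) {a σ c : ℝ} (ha : 0 ≤ a) (hc : 0 ≤ c)
    (hA : ∀ v w : EuclideanSpace ℝ (Fin n), ⟪A v, w⟫ = ⟪v, A w⟫) (hσ : ∀ v : EuclideanSpace ℝ (Fin n), σ * ‖v‖ ^ 2 ≤ ⟪v, A v⟫)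
    (Pp : 𝔓 → EuclideanSpace ℝ (Fin n) → ℝ) (hP : ∀ p, ContDiff ℝ 3 (Pp p)) (S : 𝔓 → Finset B) {ν : ℕ}
    (hν : ∀ b, (univ.filter fun p => b ∈ S p).card ≤ ν)
    (hloc : ∀ z ∈ (L : Set (EuclideanSpace ℝ (Fin n))) ∩ {y | ∀ b, ‖Q b y‖ ≤ a}, ∀ p (r : Fin 3 → B) (s : Fin 3), s ≠ 0 → r s ∉ S p →
      (iteratedFDeriv ℝ 3 (Pp p) z).compContinuousLinearMap (fun i => Q (r i)) = 0)
    (hcell : ∀ z ∈ (L : Set (EuclideanSpace ℝ (Fin n))) ∩ {y | ∀ b, ‖Q b y‖ ≤ a}, ∀ p (s : Fin 3), s ≠ 0 → ∀ b ∈ S p,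
      ∑ r ∈ univ.filter (fun r : Fin 3 → B => r s = b), ‖(iteratedFDeriv ℝ 3 (Pp p) z).compContinuousLinearMap (fun i => Q (r i))‖ ≤ c) :
    ∀ x ∈ (L : Set (EuclideanSpace ℝ (Fin n))) ∩ {y | ∀ b, ‖Q b y‖ ≤ a},
      ∀ y ∈ (L : Set (EuclideanSpace ℝ (Fin n))) ∩ {y | ∀ b, ‖Q b y‖ ≤ a},
        (⟪x, A x⟫ + ∑ p, Pp p x) + ⟪gradient (fun z : EuclideanSpace ℝ (Fin n) => ⟪z, A z⟫ + ∑ p, Pp p z) x, y - x⟫ +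
          (2 * σ - (‖iteratedFDeriv ℝ 2 (fun z => ∑ p, Pp p z) 0‖ + ν * c * a)) / 2 * ‖y - x‖ ^ 2 ≤ ⟪y, A y⟫ + ∑ p, Pp p y :=
  firstOrderOn_quadratic_add_of_blockFibreSums_blockWindow A Q hQ hQ2 hidem L ha hA hσ
    (ContDiff.sum fun p _ => hP p) (mul_nonneg (Nat.cast_nonneg ν) hc)
    (blockFibreSum_thirdDeriv_sum_le Pp hP Q S 1 _ (fun z hz p r h => hloc z hz p r 1 one_ne_zero h) hc
      (fun z hz p b hb => hcell z hz p 1 one_ne_zero b hb) hν)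
    (blockFibreSum_thirdDeriv_sum_le Pp hP Q S 2 _ (fun z hz p r h => hloc z hz p r 2 (by decide) h) hc
      (fun z hz p b hb => hcell z hz p 2 (by decide) b hb) hν)

end Summit.QuantumFields.BalabanUV.T4Continuum.NE7b.ConvexWindowSuppliersCells

end
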